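import Summits.AnomalousDissipation.AnomalousDissipation.Theses.DopplerClock
import Summits.AnomalousDissipation.AnomalousDissipation.Theorems.ImpulseGridMeanMomentumBalance
import Literature.Analysis.FluidPDE.DoeringFoiasPowerProofs
import Literature.Analysis.FluidPDE.LerayHopfMomentum

/-!
# Route DopplerClock (AnomalousDissipation) — crux `QuadratureStressFloor` (stmt-AnomalousDissipation-18129),
# line `laminar-burst-shadowing` (payload slug `Sketch`): INJECTION PAYS FOR THE FLUCTUATION ENERGY

Door (b) of the energy-free reading of the crux (registered stub `stub_injectionPaysEnergy`). Along a global
Leray–Hopf solution of `NS_ν` (`ν > 0`) on `T³` under a steady smooth mean-zero force `f`, with a sup-energy bound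
(only to make Cesàro means honest) and any generalized limit `Λ`:

`4π²ν · Λ⟨‖u‖₂² − ‖ū‖²⟩ ≤ Λ⟨(f,u)⟩`, `ū = ∫ u(1)` the conserved momentum, i.e. `4π²ν Λ⟨‖u − ū‖₂²⟩ ≤ Λ⟨(f,u)⟩`.

Proof: the integrated Poincaré inequality at the conserved momentum
(`Torus.IsGlobalLerayHopf.intervalIntegral_norm_sq_le_dissipation`) and the energy inequality from `0`, divided by `T`,
under `Λ` (monotone on eventually bounded functions; `Λ(½‖u₀‖₂²/T) = 0`). Consequence (with the energy-free bridge
`stub_bridgeEnergyFreeInjectionFloor`): a no-leak drift-`V` family whose `Λ`-mean fluctuation energy is `≥ η'/ν_j`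
already has the injection floor `4π²η'` and gives the crux — the "anti-sweeping condensate" door that the crux's
dropped energy clause opens (such a family would refute the route's other crux `InjectionControlsEnergy`).
(Doering–Foias 2002 §2, `ε ≥ νλ₁U'²`; Foias–Manley–Rosa–Temam 2001 Ch. IV §1.3.) No new definitions.
-/

noncomputable section

-- `Summit.<Summit>.<Problem>` is the tree's mandated summit-side namespace (CONVENTIONS §2); for this
-- single-conjunct summit the two coincide, so the duplicate is deliberate.
set_option linter.dupNamespace false

open MeasureTheory Set Filter Topology
open scoped InnerProductSpace RealInnerProductSpace

namespace Summit.AnomalousDissipation.AnomalousDissipation.Theorems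

open Literature.Analysis.FunctionSpaces Literature.Analysis.FunctionSpaces.Torus
open Literature.Analysis.FluidPDE Literature.Analysis.FluidPDE.Torus

namespace EnergyFreeBridge

variable {ν : ℝ} {f u₀ : UnitAddTorus (Fin 3) → EuclideanSpace ℝ (Fin 3)}
  {u : ℝ → UnitAddTorus (Fin 3) → EuclideanSpace ℝ (Fin 3)}

/-- **Injection pays for the fluctuation energy (door (b) of the energy-free reading).** Along a global
Leray–Hopf solution of `NS_ν` (`ν > 0`) on `T³` under a steady smooth mean-zero force `f`, with
`sup_{t ≥ 0} ½‖u(t)‖₂² < ∞` (only to make the Cesàro means honest) and any generalized limit `Λ`: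
`4π²ν · Λ⟨‖u‖₂² − ‖ū‖²⟩ ≤ Λ⟨(f,u)⟩`, `ū = ∫ u(1)` the conserved momentum (so `‖u(t)‖₂² − ‖ū‖² = ‖u(t) − ū‖₂²`):
the integrated Poincaré inequality at the conserved momentum and the energy inequality from `0`, divided by `T`,
under `Λ`. Hence a no-leak drift family whose `Λ`-mean fluctuation energy is `≥ η'/ν_j` already has the injection
floor `4π²η'` (Doering–Foias 2002, §2: `ε ≥ νλ₁U'²`). [folklore] -/
theorem longTimeAvg_norm_sq_sub_le (Λ : GeneralizedLimit) (hν : 0 < ν) (hf : IsSmooth f)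
    (hf0 : HasZeroMean f) (hu : IsGlobalLerayHopf ν (fun _ => f) u₀ u)
    (hsup : ∃ C : ℝ, ∀ t : ℝ, 0 ≤ t → kineticEnergy (u t) ≤ C) :
    4 * Real.pi ^ 2 * ν * Λ.longTimeAvg (fun t => (∫ x, ‖u t x‖ ^ 2) - ‖∫ x, u 1 x‖ ^ 2) ≤
      Λ.longTimeAvg (fun t => ∫ x, ⟪f x, u t x⟫) := by
  obtain ⟨C, hC⟩ := hsup
  set E : ℝ → ℝ := fun t => ∫ x, ‖u t x‖ ^ 2 with hEdef
  set P : ℝ → ℝ := fun t => ∫ x, ⟪f x, u t x⟫ with hPdef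
  set M : ℝ := ‖∫ x, u 1 x‖ ^ 2 with hMdef
  set W : ℝ → ℝ := fun t => E t - M with hWdef
  obtain ⟨Kf, hKf0, hKf⟩ := exists_nonneg_forall_norm_le_of_continuous hf.continuous
  -- finite-time form: `4π²ν T⁻¹∫₀ᵀ (E − M) ≤ ½‖u₀‖² T⁻¹ + T⁻¹∫₀ᵀ P`
  have hfin : ∀ T : ℝ, 0 < T → 4 * Real.pi ^ 2 * ν * timeMean W T ≤
      kineticEnergy u₀ * T⁻¹ + timeMean P T := by
    intro T hT
    have hPoinc : 4 * Real.pi ^ 2 * ∫ t in (0 : ℝ)..T, E t ≤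
        (∫⁻ τ in Ioo 0 T, eGradNormSq (u τ)).toReal + 4 * Real.pi ^ 2 * M * T :=
      hu.intervalIntegral_norm_sq_le_dissipation hf hf0 hT
    have hEI : kineticEnergy (u T) + ν * (∫⁻ τ in Ioo 0 T, eGradNormSq (u τ)).toReal ≤
        kineticEnergy u₀ + ∫ t in (0 : ℝ)..T, P t :=
      (hu T hT).energy_ineq_zero T ⟨hT.le, le_rfl⟩
    have hKT : 0 ≤ kineticEnergy (u T) := kineticEnergy_nonneg _
    have hEint : IntervalIntegrable E volume 0 T :=
      (intervalIntegrable_iff_integrableOn_Ioc_of_le hT.le).2 (hu.integrableOn_integral_norm_sq hT)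
    have hWint : ∫ t in (0 : ℝ)..T, W t = (∫ t in (0 : ℝ)..T, E t) - M * T := by
      simp only [hWdef]
      rw [intervalIntegral.integral_sub hEint _root_.intervalIntegrable_const,
        intervalIntegral.integral_const, sub_zero, smul_eq_mul, mul_comm]
    have h1 : 4 * Real.pi ^ 2 * ν * ∫ t in (0 : ℝ)..T, W t ≤ kineticEnergy u₀ + ∫ t in (0 : ℝ)..T, P t := by
      rw [hWint]
      have h2 := mul_le_mul_of_nonneg_left hPoinc hν.le
      nlinarith
    unfold timeMean
    have hTi : 0 < T⁻¹ := inv_pos.2 hT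
    have h3 := mul_le_mul_of_nonneg_left h1 hTi.le
    have h4 : T⁻¹ * (kineticEnergy u₀ + ∫ t in (0 : ℝ)..T, P t) =
        kineticEnergy u₀ * T⁻¹ + T⁻¹ * ∫ t in (0 : ℝ)..T, P t := by ring
    nlinarith
  -- boundedness of the Cesàro means
  have hE0 : ∀ t, 0 ≤ E t := fun t => integral_nonneg fun _ => sq_nonneg _
  have hPbd : ∀ t : ℝ, 0 < t → |P t| ≤ Kf * (2⁻¹ * (1 + 2 * C)) := by
    intro t ht
    have heq : P t = ∫ x, ⟪u t x, f x⟫ :=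
      integral_congr_ae (ae_of_all _ fun x => real_inner_comm _ _)
    rw [heq]
    exact impulseGrid_abs_integral_inner_le hu hKf0 hKf hC ht.le
  have hg : IsBoundedUnder (· ≥ ·) atTop (fun T => 4 * Real.pi ^ 2 * ν * timeMean W T) := by
    refine ⟨4 * Real.pi ^ 2 * ν * (-M), ?_⟩
    rw [eventually_map]
    filter_upwards [eventually_gt_atTop (0 : ℝ)] with T hT
    have hWlo : -M ≤ timeMean W T := by
      have hpt : ∀ t, -M ≤ W t := fun t => by
        simp only [hWdef]
        linarith [hE0 t]
      have hWi : IntervalIntegrable W volume 0 T :=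
        ((intervalIntegrable_iff_integrableOn_Ioc_of_le hT.le).2
          (hu.integrableOn_integral_norm_sq hT)).sub _root_.intervalIntegrable_const
      unfold timeMean
      have h1 : ∫ t in (0 : ℝ)..T, (-M) ≤ ∫ t in (0 : ℝ)..T, W t :=
        intervalIntegral.integral_mono_on hT.le _root_.intervalIntegrable_const hWi fun t _ => hpt t
      rw [intervalIntegral.integral_const, sub_zero, smul_eq_mul] at h1
      rw [le_inv_mul_iff₀ hT]
      linarith
    exact mul_le_mul_of_nonneg_left hWlo (by positivity)
  have hh : IsBoundedUnder (· ≤ ·) atTop (fun T => kineticEnergy u₀ * T⁻¹ + timeMean P T) := by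
    refine ⟨kineticEnergy u₀ + Kf * (2⁻¹ * (1 + 2 * C)), ?_⟩
    rw [eventually_map]
    filter_upwards [eventually_ge_atTop (1 : ℝ)] with T hT1
    have hT : 0 < T := by linarith
    have hE0' : 0 ≤ kineticEnergy u₀ := kineticEnergy_nonneg u₀
    have h1 : kineticEnergy u₀ * T⁻¹ ≤ kineticEnergy u₀ := by
      have hTi : T⁻¹ ≤ 1 := inv_le_one_of_one_le₀ hT1
      calc kineticEnergy u₀ * T⁻¹ ≤ kineticEnergy u₀ * 1 := mul_le_mul_of_nonneg_left hTi hE0'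
        _ = kineticEnergy u₀ := mul_one _
    have h2 : timeMean P T ≤ Kf * (2⁻¹ * (1 + 2 * C)) :=
      (le_abs_self _).trans (abs_timeMean_le hT fun t ht _ => hPbd t ht)
    exact add_le_add h1 h2
  have hle : ∀ᶠ T in atTop, 4 * Real.pi ^ 2 * ν * timeMean W T ≤ kineticEnergy u₀ * T⁻¹ + timeMean P T :=
    (eventually_gt_atTop 0).mono fun T hT => hfin T hT
  have hmono := Λ.apply_mono hg hh hle
  have hdecay : Λ (fun T : ℝ => kineticEnergy u₀ * T⁻¹) = 0 := by
    refine Λ.apply_eq_of_tendsto ?_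
    simpa using tendsto_inv_atTop_zero.const_mul (kineticEnergy u₀)
  have hL : Λ (fun T => 4 * Real.pi ^ 2 * ν * timeMean W T) = 4 * Real.pi ^ 2 * ν * Λ (timeMean W) := by
    have : (fun T => 4 * Real.pi ^ 2 * ν * timeMean W T) = (4 * Real.pi ^ 2 * ν) • timeMean W := by
      funext T
      simp only [Pi.smul_apply, smul_eq_mul]
    rw [this, map_smul, smul_eq_mul]
  have hR : Λ (fun T => kineticEnergy u₀ * T⁻¹ + timeMean P T) = Λ (timeMean P) := by
    have : (fun T => kineticEnergy u₀ * T⁻¹ + timeMean P T) =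
        (fun T : ℝ => kineticEnergy u₀ * T⁻¹) + timeMean P := by
      funext T
      simp only [Pi.add_apply]
    rw [this, map_add, hdecay, zero_add]
  unfold GeneralizedLimit.longTimeAvg
  rw [hL, hR] at hmono
  exact hmono

end EnergyFreeBridge

/-- **Registered stub `stub_injectionPaysEnergy` of line `Sketch` (crux `QuadratureStressFloor`,
stmt-AnomalousDissipation-18129), verbatim registered signature:** `4π²ν Λ⟨‖u‖₂² − ‖ū‖²⟩ ≤ Λ⟨(f,u)⟩` along a global
Leray–Hopf solution under a steady smooth mean-zero force (`EnergyFreeBridge.longTimeAvg_norm_sq_sub_le`). [folklore] -/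
theorem stub_injectionPaysEnergy :
    ∀ (Λ : Literature.Analysis.FluidPDE.GeneralizedLimit) (ν : ℝ)
      (f u₀ : UnitAddTorus (Fin 3) → EuclideanSpace ℝ (Fin 3))
      (u : ℝ → UnitAddTorus (Fin 3) → EuclideanSpace ℝ (Fin 3)),
      0 < ν →
      Literature.Analysis.FunctionSpaces.Torus.IsSmooth f →
      Literature.Analysis.FunctionSpaces.Torus.HasZeroMean f →
      Literature.Analysis.FluidPDE.Torus.IsGlobalLerayHopf ν (fun _ => f) u₀ u →
      (∃ C : ℝ, ∀ t : ℝ, 0 ≤ t → Literature.Analysis.FunctionSpaces.Torus.kineticEnergy (u t) ≤ C) →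
      4 * Real.pi ^ 2 * ν * Λ.longTimeAvg (fun t => (∫ x, ‖u t x‖ ^ 2) - ‖∫ x, u 1 x‖ ^ 2) ≤
        Λ.longTimeAvg (fun t => ∫ x, inner ℝ (f x) (u t x)) :=
  fun Λ _ν _f _u₀ _u hν hf hf0 hu hsup => EnergyFreeBridge.longTimeAvg_norm_sq_sub_le Λ hν hf hf0 hu hsup

end Summit.AnomalousDissipation.AnomalousDissipation.Theorems

end
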